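import Summits.Ventures.CertifiedManyBodySolver.Upper.IntervalReaderBytes
import Summits.Ventures.CertifiedManyBodySolver.Upper.IntervalReaderH1

/-!
# Ventures/CertifiedManyBodySolver — Upper/IntervalReaderRecipe.lean: the per-step defect bound FROM THE
RECIPE (Theorem H1′, part 26)

HONEST FRAMING: first certified bounds; not a superconductivity verdict; every number certified (two
readers) or labelled float.  This file is about A READER'S OWN ARITHMETIC (`l3core/h1sweep.py`, binary of record
`l3core 0.6.9` 5fda02e5cf27520d; the same sweep under `l3core-sgf 0.1.10`) and says nothing about the Hubbard
model, a producer, a row, or the thermodynamic limit.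

Parts 3 and 12 (`h1prime_step_defect_le`, `automatonSweep_error_le`, `h1_sweep_error_le`) take, per sweep step,
the HYPOTHESIS `‖X̂′ − Σ_b T_{O_b}(X̂_b)‖₂ ≤ ρ` — the total rounding defect of the step.  Part 25 proved that the
code's rounding map `round_shift` moves a grid entry by at most half a grid unit.  This part puts the two
together and DERIVES the per-step hypothesis from the RECIPE the bytes follow (`h1_sweep`, `midround=True`):

  for each source state `b`:  `Pm[b,s′] := round_shift(X̂I[b] · AI[s′], p)`      (only for the `s′` it needs)
  `acc := Σ_b Σ_{s,s′} OI[b][s,s′] · AI[s]ᵀ · Pm[b,s′]`                         (exact integers)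
  `X̂I′ := round_shift(acc, p)`

where `X̂I` are the stored integer environments (value `X̂I·2^(−P)`), `AI` the integer site slices (value
`AI·2^(−p)`), `OI` the integer automaton entries.  THEOREM `recipe_step_defect_le`: reading everything on the
grid (`gridMat e V = V·2^(−e)` as a `𝕜`-matrix, `𝕜 = ℝ` or `ℂ`),

  `‖X̂′ − Σ_b transferOp A (O b) (X̂ b)‖₂ ≤ Σ_b √κ·√(R_b C_b)·√(#need b)·√(#m·#n)·2^(−P−1) + √(#n·#n)·2^(−P−1)`,

i.e. EXACTLY the shape of part 3's bound with `D¹`, `D` now the recipe's own rounding defects — and term by term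
`≤` the code's radius increment `Σ_b on_b·(sk·SQ[#need b]·rho1_one) + rho` (`on ≥ √(RC)` part 1
`sqrt_mul_le_max`; `sk ≥ √κ`, `SQ[n] ≥ √n`, `rho1_one ≥ √(χ_x χ_{x+1})·2^(−P−1)` part 25 `sqrt_le_isqrtCeil`;
`_rup` outward, part 25 `le_rup`): `recipe_radius_dominates`.  So the `_hρ` hypothesis of part 12 holds for the
bytes with the code's printed `ρ`, GIVEN ONLY that the integer products / sums / shifts are computed exactly
(part 25 §D–§E: limb GEMM exact under (A1); int64 kernels bit-tested).

Also: `gridMat` algebra (`gridMat_add/sum/intCast_smul/mul/conjTranspose`), the `𝕜`-valued form of part 25's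
defect bound (`gridMat_roundShift_sub_norm_le`), `sqrt_sum_sq_le_of_subset` (the `SQ[#need]` factor).
Elementary; Mathlib + parts 1–3, 25 only.
-/

noncomputable section

open Matrix Finset WithLp
open scoped BigOperators ComplexOrder

namespace Summit.Ventures.CertifiedManyBodySolver.Upper.IntervalReader

section Grid

variable {𝕜 : Type*} [RCLike 𝕜]
variable {m n l : Type*}

/-- An integer matrix `V` read on the dyadic grid of scale `2^(−e)`: the `𝕜`-matrix `V · 2^(−e)` (entries cast
through `ℝ`).  The reader's environments are `gridMat P X̂I`, its site slices `gridMat p AI`. -/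
def gridMat (e : ℕ) (V : Matrix m n ℤ) : Matrix m n 𝕜 :=
  Matrix.of fun i j => (((V i j : ℝ) / 2 ^ e : ℝ) : 𝕜)

/-- Entry of `gridMat`. -/
@[simp] theorem gridMat_apply (e : ℕ) (V : Matrix m n ℤ) (i : m) (j : n) :
    (gridMat e V : Matrix m n 𝕜) i j = (((V i j : ℝ) / 2 ^ e : ℝ) : 𝕜) := rfl

/-- `gridMat` is additive. -/
theorem gridMat_add (e : ℕ) (V W : Matrix m n ℤ) :
    (gridMat e (V + W) : Matrix m n 𝕜) = gridMat e V + gridMat e W := by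
  ext i j; simp [gridMat, add_div]

/-- `gridMat` of a finite sum. -/
theorem gridMat_sum {ι : Type*} (e : ℕ) (s : Finset ι) (V : ι → Matrix m n ℤ) :
    (gridMat e (∑ x ∈ s, V x) : Matrix m n 𝕜) = ∑ x ∈ s, gridMat e (V x) := by
  classical
  induction s using Finset.induction_on with
  | empty => ext i j; simp [gridMat]
  | insert a s ha ih => rw [Finset.sum_insert ha, Finset.sum_insert ha, gridMat_add, ih]

/-- An integer scalar passes through `gridMat`: `(z : 𝕜) • gridMat e V = gridMat e (z • V)`. -/
theorem gridMat_intCast_smul (e : ℕ) (z : ℤ) (V : Matrix m n ℤ) :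
    ((z : 𝕜) • gridMat e V : Matrix m n 𝕜) = gridMat e (z • V) := by
  ext i j
  simp only [Matrix.smul_apply, gridMat_apply, smul_eq_mul, Matrix.smul_apply, Int.cast_mul, mul_div_assoc]
  push_cast
  ring

/-- Products multiply the scales: `gridMat e V * gridMat e′ W = gridMat (e + e′) (V * W)`. -/
theorem gridMat_mul [Fintype n] (e e' : ℕ) (V : Matrix m n ℤ) (W : Matrix n l ℤ) :
    (gridMat e V * gridMat e' W : Matrix m l 𝕜) = gridMat (e + e') (V * W) := by
  ext i j
  simp only [Matrix.mul_apply, gridMat_apply, Int.cast_sum, Int.cast_mul, Finset.sum_div, pow_add]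
  push_cast
  refine Finset.sum_congr rfl fun x _ => ?_
  field_simp

/-- Real entries: the conjugate transpose of a grid matrix is the grid matrix of the transpose. -/
theorem gridMat_conjTranspose (e : ℕ) (V : Matrix m n ℤ) :
    (gridMat e V : Matrix m n 𝕜)ᴴ = gridMat e Vᵀ := by
  ext i j
  simp [gridMat, Matrix.conjTranspose_apply, RCLike.star_def, RCLike.conj_ofReal]

/-- The zero matrix reads as zero. -/
@[simp] theorem gridMat_zero (e : ℕ) : (gridMat e (0 : Matrix m n ℤ) : Matrix m n 𝕜) = 0 := by
  ext i j; simp [gridMat]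

end Grid

section L2

open scoped Matrix.Norms.L2Operator InnerProductSpace

variable {𝕜 : Type*} [RCLike 𝕜]
variable {m n S : Type*} [Fintype m] [Fintype n] [Fintype S]

/-- **Part 25's defect bound, `𝕜`-valued.**  Rounding an exact integer block `V` at scale `2^(−(P+s))` to the
grid `2^(−P)` by `roundShift · s` gives a defect of `L²` operator norm `≤ √(#m·#n)·2^(−P−1)`. -/
theorem gridMat_roundShift_sub_norm_le [DecidableEq n] (V : Matrix m n ℤ) (s P : ℕ) :
    ‖(gridMat P (V.map (roundShift · s)) - gridMat (P + s) V : Matrix m n 𝕜)‖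
      ≤ Real.sqrt (Fintype.card m * Fintype.card n) * (1 / 2 ^ (P + 1)) := by
  refine l2_opNorm_le_of_forall_norm_entry_le _ (by positivity) fun i j => ?_
  rw [Matrix.sub_apply, gridMat_apply, gridMat_apply, Matrix.map_apply, ← RCLike.ofReal_sub,
    RCLike.norm_ofReal]
  exact roundShift_grid_sub_le (V i j) s P

/-- The `SQ[#need]` factor: if `‖W s′‖ ≤ ε` on a finite set `T` and `W s′ = 0` off it, then
`√(Σ_{s′} ‖W s′‖²) ≤ √#T · ε`. -/
theorem sqrt_sum_sq_le_of_subset {E : Type*} [SeminormedAddCommGroup E] [DecidableEq S] (T : Finset S)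
    (W : S → E) {ε : ℝ} (hε : 0 ≤ ε) (hT : ∀ s' ∈ T, ‖W s'‖ ≤ ε) (hoff : ∀ s' ∉ T, W s' = 0) :
    Real.sqrt (∑ s', ‖W s'‖ ^ 2) ≤ Real.sqrt T.card * ε := by
  have hsum : ∑ s', ‖W s'‖ ^ 2 ≤ T.card * ε ^ 2 := by
    have hsplit : ∑ s', ‖W s'‖ ^ 2 = ∑ s' ∈ T, ‖W s'‖ ^ 2 := by
      rw [← Finset.sum_subset (Finset.subset_univ T)]
      intro s' _ hs'
      simp [hoff s' hs']
    rw [hsplit]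
    calc ∑ s' ∈ T, ‖W s'‖ ^ 2 ≤ ∑ _s' ∈ T, ε ^ 2 :=
          Finset.sum_le_sum fun s' hs' => pow_le_pow_left₀ (norm_nonneg _) (hT s' hs') 2
      _ = T.card * ε ^ 2 := by rw [Finset.sum_const, nsmul_eq_mul]
  calc Real.sqrt (∑ s', ‖W s'‖ ^ 2) ≤ Real.sqrt (T.card * ε ^ 2) := Real.sqrt_le_sqrt hsum
    _ = Real.sqrt T.card * ε := by rw [Real.sqrt_mul (Nat.cast_nonneg _), Real.sqrt_sq hε]

/-- **THE PER-STEP DEFECT FROM THE RECIPE** (`h1_sweep`, `midround=True`, one target state `c`; `O b` = the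
summed integer site operator of the transition `b → c`, `need b` ⊇ the `s′` with a non-zero column).  Stored
integer environments `XI b` (scale `2^(−P)`), integer slices `AI s` (scale `2^(−p)`); the code forms
`PmI b s′ = round_shift(XI b · AI s′, p)` for `s′ ∈ need b`, accumulates `Σ_b Σ_{s,s′∈need b} OI b s s′ · (AI s)ᵀ · PmI b s′`
exactly, and stores `XI′ = round_shift(acc, p)`.  Then, on the grid, the distance of the stored `X̂′` to the EXACT
transfer of the stored inputs is at most
`Σ_b √κ·√(R_b·C_b)·(√#need b · √(#m·#n)·2^(−P−1)) + √(#n·#n)·2^(−P−1)` — part 3's `h1prime_step_defect_le` with its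
defect blocks `D¹`, `D` INSTANTIATED by the recipe's roundings and bounded by part 25.  (`κ`: any Gram constant of
the grid slices, part 2; `R_b, C_b`: bounds of the absolute row / column sums of `O b`, part 1.) -/
theorem recipe_step_defect_le [DecidableEq m] [DecidableEq n] [DecidableEq S] {β : Type*} [Fintype β]
    (AI : S → Matrix m n ℤ) (p : ℕ) {κ : ℝ} (hκ0 : 0 ≤ κ)
    (hκ : ∀ z : EuclideanSpace 𝕜 n,
      ∑ s, ‖toLp 2 ((gridMat p (AI s) : Matrix m n 𝕜) *ᵥ ofLp z)‖ ^ 2 ≤ κ * ‖z‖ ^ 2)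
    (OI : β → Matrix S S ℤ) {R C : β → ℝ} (hR0 : ∀ b, 0 ≤ R b) (hC0 : ∀ b, 0 ≤ C b)
    (hrow : ∀ b s, ∑ s', ‖((OI b s s' : ℤ) : 𝕜)‖ ≤ R b) (hcol : ∀ b s', ∑ s, ‖((OI b s s' : ℤ) : 𝕜)‖ ≤ C b)
    (need : β → Finset S) (hneed : ∀ b s s', s' ∉ need b → OI b s s' = 0)
    (XI : β → Matrix m m ℤ) (P : ℕ)
    (PmI : β → S → Matrix m n ℤ) (hPm : ∀ b, ∀ s' ∈ need b, PmI b s' = (XI b * AI s').map (roundShift · p))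
    (XI' : Matrix n n ℤ)
    (hX' : XI' = (∑ b, ∑ s, ∑ s' ∈ need b, OI b s s' • ((AI s)ᵀ * PmI b s')).map (roundShift · p)) :
    ‖(gridMat P XI' : Matrix n n 𝕜)
        - ∑ b, transferOp (fun s => (gridMat p (AI s) : Matrix m n 𝕜)) ((OI b).map (Int.cast : ℤ → 𝕜))
            (gridMat P (XI b))‖
      ≤ ∑ b, Real.sqrt κ * Real.sqrt (R b * C b)
            * (Real.sqrt (need b).card * (Real.sqrt (Fintype.card m * Fintype.card n) * (1 / 2 ^ (P + 1))))
        + Real.sqrt (Fintype.card n * Fintype.card n) * (1 / 2 ^ (P + 1)) := by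
  -- the grid objects
  set A : S → Matrix m n 𝕜 := fun s => gridMat p (AI s) with hA
  set O : β → Matrix S S 𝕜 := fun b => (OI b).map (Int.cast : ℤ → 𝕜) with hO
  set Xh : β → Matrix m m 𝕜 := fun b => gridMat P (XI b) with hXh
  -- the recipe's rounding defects: intermediate (`D1`, zero off `need`) and final (`D`)
  set D1 : β → S → Matrix m n 𝕜 := fun b s' =>
    if s' ∈ need b then gridMat P (PmI b s') - Xh b * A s' else 0 with hD1
  set acc : Matrix n n ℤ := ∑ b, ∑ s, ∑ s' ∈ need b, OI b s s' • ((AI s)ᵀ * PmI b s') with hacc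
  set D : Matrix n n 𝕜 := gridMat P XI' - gridMat (P + p) acc with hD
  have hO_apply : ∀ b s s', O b s s' = ((OI b s s' : ℤ) : 𝕜) := fun b s s' => rfl
  -- the rounded intermediate products, on the grid: `Xh b * A s' + D1 b s' = gridMat P (PmI b s')` on `need b`
  have hmid : ∀ b s s', O b s s' • ((A s)ᴴ * (Xh b * A s' + D1 b s'))
      = if s' ∈ need b then (gridMat (p + P) (OI b s s' • ((AI s)ᵀ * PmI b s')) : Matrix n n 𝕜) else 0 := by
    intro b s s'
    by_cases hs' : s' ∈ need b
    · rw [if_pos hs', hD1]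
      simp only [if_pos hs', add_sub_cancel, hA, hO_apply]
      rw [gridMat_conjTranspose, gridMat_mul, gridMat_intCast_smul]
    · rw [if_neg hs', hO_apply, hneed b s s' hs']
      simp
  -- hence the exact accumulation of the rounded intermediates is `gridMat (P + p) acc`
  have hsum : ∑ b, ∑ s, ∑ s', O b s s' • ((A s)ᴴ * (Xh b * A s' + D1 b s'))
      = (gridMat (P + p) acc : Matrix n n 𝕜) := by
    simp only [hmid, Finset.sum_ite_mem, Finset.univ_inter, hacc, gridMat_sum, Nat.add_comm p P]
  -- part 3's defect split, instantiated
  have hstep : (gridMat P XI' : Matrix n n 𝕜)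
      = ∑ b, ∑ s, ∑ s', O b s s' • ((A s)ᴴ * (Xh b * A s' + D1 b s')) + D := by
    rw [hsum, hD, add_sub_cancel]
  have hmain := h1prime_step_defect_le A hκ0 hκ O hR0 hC0
    (fun b s => by simpa only [hO_apply] using hrow b s) (fun b s' => by simpa only [hO_apply] using hcol b s')
    Xh D1 D (gridMat P XI') hstep
  refine hmain.trans (add_le_add (Finset.sum_le_sum fun b _ => ?_) ?_)
  · -- intermediate defects: part 25 on `need b`, zero elsewhere
    refine mul_le_mul_of_nonneg_left ?_ (by positivity)
    refine sqrt_sum_sq_le_of_subset (need b) (D1 b) (by positivity) (fun s' hs' => ?_) (fun s' hs' => ?_)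
    · rw [hD1]; simp only [if_pos hs']
      rw [hPm b s' hs', hXh, hA]; simp only
      rw [gridMat_mul]
      exact gridMat_roundShift_sub_norm_le (XI b * AI s') p P
    · rw [hD1]; simp only [if_neg hs']
  · -- final defect: part 25 on the accumulated block
    rw [hD, hX']
    exact gridMat_roundShift_sub_norm_le acc p P

/-- **The code's radius increment dominates the recipe bound.**  With `on_b ≥ √(R_b C_b)` (`opnorm_bound`,
part 1 `sqrt_mul_le_max`), `sk ≥ √κ`, `sq_b ≥ √#need b`, `r1 ≥ √(#m·#n)·2^(−P−1)` (`isqrt_ceil_fraction`, part 25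
`sqrt_le_isqrtCeil`) and `rho ≥ √(#n·#n)·2^(−P−1)`, the per-step bound of `recipe_step_defect_le` is
`≤ Σ_b on_b·(sk·sq_b·r1) + rho` = the defect part of `newr1[c] += on·(kap·r1[b] + me)`, `r1 = _rup(newr1 + rho)`
(`me = sk·SQ[#need]·rho1_one`) — so part 12's `_hρ` / `_hr` hold with the code's printed radii. -/
theorem recipe_radius_dominates {β : Type*} [Fintype β] {κ : ℝ} {R C on sq : β → ℝ} {sk r1 rho e1 e0 : ℝ}
    {cn : β → ℝ} (he1 : 0 ≤ e1) (hsk0 : 0 ≤ sk)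
    (hon : ∀ b, Real.sqrt (R b * C b) ≤ on b) (hsk : Real.sqrt κ ≤ sk) (hsq : ∀ b, Real.sqrt (cn b) ≤ sq b)
    (hr1 : e1 ≤ r1) (hrho : e0 ≤ rho) :
    ∑ b, Real.sqrt κ * Real.sqrt (R b * C b) * (Real.sqrt (cn b) * e1) + e0
      ≤ ∑ b, on b * (sk * sq b * r1) + rho := by
  refine add_le_add (Finset.sum_le_sum fun b _ => ?_) hrho
  have h1 : Real.sqrt κ * Real.sqrt (R b * C b) ≤ sk * on b :=
    mul_le_mul hsk (hon b) (Real.sqrt_nonneg _) hsk0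
  have h2 : Real.sqrt (cn b) * e1 ≤ sq b * r1 :=
    mul_le_mul (hsq b) hr1 he1 ((Real.sqrt_nonneg _).trans (hsq b))
  calc Real.sqrt κ * Real.sqrt (R b * C b) * (Real.sqrt (cn b) * e1)
      ≤ (sk * on b) * (sq b * r1) :=
        mul_le_mul h1 h2 (mul_nonneg (Real.sqrt_nonneg _) he1)
          (mul_nonneg hsk0 ((Real.sqrt_nonneg _).trans (hon b)))
    _ = on b * (sk * sq b * r1) := by ring

end L2

end Summit.Ventures.CertifiedManyBodySolver.Upper.IntervalReader

end
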